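import Mathlib.NumberTheory.ArithmeticFunction.VonMangoldt
import Literature.NumberTheory.Sieve.IwaniecAlmostPrimes

/-!
# SoloInformedVonMangoldtSplit — the exact divisor-size decomposition of `∑_{n ≤ x} Λ(n² + 1)`

Soloist `solo-Parity-informed`, session 6 (claim C31).  First half of the kernel version of the
port schema C28 (sessions 4–5, `PLAN.md` §9): the three-range architecture of the one proved quadratic
Bateman–Horn theorem (Sawin–Shusterman over `𝔽_q[u]`, arXiv:2008.09905, proof of Thm 8.1) transcribed
to `ℤ` and `n² + 1`, as exact identities and one unconditional inequality.  No bearing on the truth of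
`Summit.Parity.BatemanHorn`; the asymptotic schema built on this file is
`SoloInformedThreeRangeSchema`.

With `Λ(N) = -∑_{d ∣ N} μ(d) log d` (Mathlib `ArithmeticFunction.sum_moebius_mul_log_eq`) and a
parameter `D`:

* `vonMangoldt_eq_split`: `Λ(N) = -∑_{d ∣ N, d ≤ D} μ(d) log d - ∑_{e ∣ N, N/e > D} μ(N/e) log(N/e)`
  (the divisors `d > D` re-indexed by their cofactor `e = N/d`);
* `sum_vonMangoldt_sq_add_one_eq_split`: summed over `1 ≤ n ≤ x`, the first piece becomes
  `-∑_{d ≤ D} μ(d) log d · #{n ≤ x : d ∣ n² + 1}` — Iwaniec's `congrCount x d = ρ(d) x/d + rem x d`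
  (`Literature.NumberTheory.Sieve.Iwaniec1978`), i.e. MAIN TERM + LEVEL-OF-DISTRIBUTION remainders —
  and the second is the COFACTOR RANGE `∑_{n ≤ x} ∑_{e ∣ n²+1, (n²+1)/e > D} μ((n²+1)/e) log((n²+1)/e)`;
* `abs_cofactorRange_le`: by Abel summation in `n` (`sum_Icc_mul_eq_abel`,
  `abs_sum_Icc_mul_le_of_monotone`) and the fact that the cut `(n²+1)/e > D` selects a final segment
  of each divisor class (`filter_Icc_sq_add_one_le`), the cofactor range is at most
  `2 (2 log(x²+1) + log E) · ∑_{e ≤ E} M(e)` whenever `|∑_{n ≤ y, e ∣ n²+1} μ((n²+1)/e)| ≤ M(e)` for all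
  `y ≤ x` and every cofactor that occurs is `≤ E`.  So the cofactor range is controlled by MÖBIUS
  CANCELLATION ALONG THE DIVISOR CLASSES `{n : e ∣ n² + 1}` — by `SoloInformedCofactorRung` /
  `SoloInformedCofactorLiouville` these are the root classes `n ≡ ν (mod e)`, `ν² ≡ -1`, and the
  summand is `μ` of the cofactor quadratic `g_{e,ν}`.

References: W. Sawin, M. Shusterman, arXiv:2008.09905, §8; H. Iwaniec, Invent. Math. 47 (1978) §§2–3
(the objects `ρ`, `congrCount`, `rem`).
-/

namespace Summit.Parity.BatemanHorn.Theorems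

open Finset ArithmeticFunction
open scoped ArithmeticFunction.Moebius
open Literature.NumberTheory.Sieve.Iwaniec1978 (rho congrCount rem)

/-! ### The split of `Λ` at divisor size `D` -/

/-- For `e ∣ N`, `e ≥ 1`: `D < N / e ↔ e * D < N`. -/
theorem lt_div_iff_mul_lt_of_dvd {e N D : ℕ} (he : 0 < e) (h : e ∣ N) :
    D < N / e ↔ e * D < N := by
  obtain ⟨q, rfl⟩ := h
  rw [Nat.mul_div_cancel_left q he]
  exact (Nat.mul_lt_mul_left he).symm

/-- `Λ(N) = -∑_{d ∣ N, d ≤ D} μ(d) log d - ∑_{e ∣ N, D < N/e} μ(N/e) log(N/e)`: Mathlib's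
`∑_{d ∣ N} μ(d) log d = -Λ(N)`, split at `d ≤ D`, the large divisors re-indexed by the cofactor. -/
theorem vonMangoldt_eq_split (N D : ℕ) :
    Λ N = -(∑ d ∈ N.divisors with d ≤ D, (μ d : ℝ) * Real.log d)
      - ∑ e ∈ N.divisors with D < N / e, (μ (N / e) : ℝ) * Real.log ((N / e : ℕ) : ℝ) := by
  have h := sum_moebius_mul_log_eq (n := N)
  simp only [log_apply] at h
  rw [← sum_filter_add_sum_filter_not N.divisors (fun d => d ≤ D)] at h
  have h2 : ∑ d ∈ N.divisors with ¬ d ≤ D, (μ d : ℝ) * Real.log d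
      = ∑ e ∈ N.divisors with D < N / e, (μ (N / e) : ℝ) * Real.log ((N / e : ℕ) : ℝ) := by
    rw [sum_filter, sum_filter, ← Nat.sum_div_divisors N
      (fun d => if ¬ d ≤ D then (μ d : ℝ) * Real.log (d : ℝ) else 0)]
    refine sum_congr rfl fun e _ => ?_
    simp only [not_le]
  rw [h2] at h
  linarith

/-- For `x : ℕ`, Iwaniec's `congrCount x d` is `#{1 ≤ n ≤ x : d ∣ n² + 1}`. -/
theorem congrCount_natCast (x d : ℕ) :
    congrCount (x : ℝ) d = #((Icc 1 x).filter fun n : ℕ => d ∣ n ^ 2 + 1) := by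
  unfold congrCount
  rw [Nat.floor_natCast]

/-- The divisors `d ≤ D` of `n² + 1` are the `d ∈ [1, D]` dividing `n² + 1`. -/
theorem divisors_filter_le_eq (n D : ℕ) :
    (n ^ 2 + 1).divisors.filter (fun d => d ≤ D) = (Icc 1 D).filter (fun d => d ∣ n ^ 2 + 1) := by
  ext d
  simp only [mem_filter, Nat.mem_divisors, mem_Icc]
  constructor
  · rintro ⟨⟨hd, -⟩, hD⟩
    exact ⟨⟨Nat.pos_of_dvd_of_pos hd (Nat.succ_pos _), hD⟩, hd⟩
  · rintro ⟨⟨-, hD⟩, hd⟩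
    exact ⟨⟨hd, Nat.succ_ne_zero _⟩, hD⟩

/-- **The divisor-size decomposition of `ψ_{n²+1}(x) = ∑_{1 ≤ n ≤ x} Λ(n² + 1)`** at level `D`:
`ψ(x) = -∑_{d ≤ D} μ(d) log d · congrCount x d - (cofactor range)`. -/
theorem sum_vonMangoldt_sq_add_one_eq_split (x D : ℕ) :
    ∑ n ∈ Icc 1 x, Λ (n ^ 2 + 1)
      = -(∑ d ∈ Icc 1 D, (μ d : ℝ) * Real.log d * congrCount (x : ℝ) d)
        - ∑ n ∈ Icc 1 x, ∑ e ∈ (n ^ 2 + 1).divisors with D < (n ^ 2 + 1) / e,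
            (μ ((n ^ 2 + 1) / e) : ℝ) * Real.log (((n ^ 2 + 1) / e : ℕ) : ℝ) := by
  have h1 : ∀ n ∈ Icc 1 x, Λ (n ^ 2 + 1)
      = -(∑ d ∈ (Icc 1 D).filter (fun d => d ∣ n ^ 2 + 1), (μ d : ℝ) * Real.log d)
        - ∑ e ∈ (n ^ 2 + 1).divisors with D < (n ^ 2 + 1) / e,
            (μ ((n ^ 2 + 1) / e) : ℝ) * Real.log (((n ^ 2 + 1) / e : ℕ) : ℝ) := by
    intro n _
    rw [vonMangoldt_eq_split (n ^ 2 + 1) D, divisors_filter_le_eq]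
  rw [sum_congr rfl h1, sum_sub_distrib, sum_neg_distrib]
  congr 2
  simp_rw [sum_filter]
  rw [sum_comm]
  refine sum_congr rfl fun d _ => ?_
  rw [← sum_filter, sum_const, nsmul_eq_mul, congrCount_natCast, mul_comm]

/-- The main term separated: `congrCount x d = ρ(d) x / d + rem x d` inside the first piece. -/
theorem sum_moebius_log_congrCount_eq (x D : ℕ) :
    ∑ d ∈ Icc 1 D, (μ d : ℝ) * Real.log d * congrCount (x : ℝ) d
      = (x : ℝ) * ∑ d ∈ Icc 1 D, (μ d : ℝ) * Real.log d * rho d / d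
        + ∑ d ∈ Icc 1 D, (μ d : ℝ) * Real.log d * rem (x : ℝ) d := by
  rw [mul_sum, ← sum_add_distrib]
  refine sum_congr rfl fun d _ => ?_
  unfold rem
  ring

/-! ### Abel summation on `[1, x]` -/

/-- Abel's identity: `∑_{n ≤ x} g(n) w(n) = G(x) w(x) - ∑_{m < x} G(m) (w(m+1) - w(m))`,
`G(y) = ∑_{1 ≤ n ≤ y} g(n)`. -/
theorem sum_Icc_mul_eq_abel (g w : ℕ → ℝ) (x : ℕ) :
    ∑ n ∈ Icc 1 x, g n * w n
      = (∑ n ∈ Icc 1 x, g n) * w x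
        - ∑ m ∈ range x, (∑ n ∈ Icc 1 m, g n) * (w (m + 1) - w m) := by
  induction x with
  | zero => simp
  | succ x ih =>
    rw [sum_Icc_succ_top (Nat.le_add_left 1 x) (fun n => g n * w n), ih,
      sum_Icc_succ_top (Nat.le_add_left 1 x) g, sum_range_succ]
    ring

/-- Abel's inequality: for `w` monotone with `w(0) ≥ 0` and all partial sums `|G(y)| ≤ M` (`y ≤ x`),
`|∑_{n ≤ x} g(n) w(n)| ≤ 2 M w(x)`. -/
theorem abs_sum_Icc_mul_le_of_monotone {g w : ℕ → ℝ} {x : ℕ} {M : ℝ} (hw : Monotone w)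
    (hw0 : 0 ≤ w 0) (hM : ∀ y ≤ x, |∑ n ∈ Icc 1 y, g n| ≤ M) :
    |∑ n ∈ Icc 1 x, g n * w n| ≤ 2 * M * w x := by
  rw [sum_Icc_mul_eq_abel]
  have hMnn : 0 ≤ M := (abs_nonneg _).trans (hM 0 (Nat.zero_le x))
  have hwx : 0 ≤ w x := hw0.trans (hw (Nat.zero_le x))
  have h1 : |(∑ n ∈ Icc 1 x, g n) * w x| ≤ M * w x := by
    rw [abs_mul, abs_of_nonneg hwx]
    exact mul_le_mul_of_nonneg_right (hM x le_rfl) hwx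
  have h2 : |∑ m ∈ range x, (∑ n ∈ Icc 1 m, g n) * (w (m + 1) - w m)|
      ≤ ∑ m ∈ range x, M * (w (m + 1) - w m) := by
    refine (abs_sum_le_sum_abs _ _).trans (sum_le_sum fun m hm => ?_)
    have hdm : 0 ≤ w (m + 1) - w m := sub_nonneg.mpr (hw (Nat.le_succ m))
    rw [abs_mul, abs_of_nonneg hdm]
    exact mul_le_mul_of_nonneg_right (hM m (mem_range.mp hm).le) hdm
  have h3 : ∑ m ∈ range x, M * (w (m + 1) - w m) = M * (w x - w 0) := by
    rw [← mul_sum, sum_range_sub]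
  calc |(∑ n ∈ Icc 1 x, g n) * w x - ∑ m ∈ range x, (∑ n ∈ Icc 1 m, g n) * (w (m + 1) - w m)|
      ≤ |(∑ n ∈ Icc 1 x, g n) * w x|
          + |∑ m ∈ range x, (∑ n ∈ Icc 1 m, g n) * (w (m + 1) - w m)| := abs_sub _ _
    _ ≤ M * w x + M * (w x - w 0) := add_le_add h1 (h2.trans h3.le)
    _ ≤ 2 * M * w x := by nlinarith [mul_nonneg hMnn hw0]

/-! ### The cut `(n²+1)/e > D` selects a final segment of each divisor class -/

/-- `{1 ≤ n ≤ y : n² + 1 ≤ M} = [1, min(y, ⌊√(M-1)⌋)]`. -/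
theorem filter_Icc_sq_add_one_le (y M : ℕ) :
    (Icc 1 y).filter (fun n : ℕ => n ^ 2 + 1 ≤ M) = Icc 1 (min y (Nat.sqrt (M - 1))) := by
  ext n
  simp only [mem_filter, mem_Icc, le_min_iff, Nat.le_sqrt']
  constructor
  · rintro ⟨⟨h1, hy⟩, hM⟩
    have hk : 1 ≤ n ^ 2 := Nat.one_le_pow _ _ h1
    refine ⟨h1, hy, ?_⟩
    generalize n ^ 2 = k at *
    omega
  · rintro ⟨h1, hy, hM⟩
    have hk : 1 ≤ n ^ 2 := Nat.one_le_pow _ _ h1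
    refine ⟨⟨h1, hy⟩, ?_⟩
    generalize n ^ 2 = k at *
    omega

/-- A sum over a divisor class cut at `e · D < n² + 1` is the difference of two uncut partial sums. -/
theorem sum_filter_dvd_cut_eq_sub (a : ℕ → ℝ) (e D y : ℕ) :
    ∑ n ∈ (Icc 1 y).filter (fun n => e ∣ n ^ 2 + 1 ∧ e * D < n ^ 2 + 1), a n
      = ∑ n ∈ (Icc 1 y).filter (fun n => e ∣ n ^ 2 + 1), a n
        - ∑ n ∈ (Icc 1 (min y (Nat.sqrt (e * D - 1)))).filter (fun n => e ∣ n ^ 2 + 1), a n := by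
  rw [eq_sub_iff_add_eq, ← filter_Icc_sq_add_one_le, filter_filter,
    ← sum_filter_add_sum_filter_not ((Icc 1 y).filter (fun n => e ∣ n ^ 2 + 1))
      (fun n => e * D < n ^ 2 + 1), filter_filter, filter_filter]
  congr 1
  refine sum_congr ?_ fun _ _ => rfl
  ext n
  simp only [mem_filter, not_lt]
  tauto

/-- Hence `|cut class sum| ≤ 2 M(e)` if all uncut partial sums up to `x` are bounded by `M(e)`. -/
theorem abs_sum_filter_dvd_cut_le {x y e D : ℕ} {Me : ℝ} (hy : y ≤ x)
    (hM : ∀ z ≤ x, |∑ n ∈ (Icc 1 z).filter (fun n => e ∣ n ^ 2 + 1),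
      (μ ((n ^ 2 + 1) / e) : ℝ)| ≤ Me) :
    |∑ n ∈ (Icc 1 y).filter (fun n => e ∣ n ^ 2 + 1 ∧ e * D < n ^ 2 + 1),
        (μ ((n ^ 2 + 1) / e) : ℝ)| ≤ 2 * Me := by
  rw [sum_filter_dvd_cut_eq_sub]
  refine (abs_sub _ _).trans ?_
  have h1 := hM y hy
  have h2 := hM (min y (Nat.sqrt (e * D - 1))) ((min_le_left _ _).trans hy)
  linarith

/-! ### The cofactor range is controlled by Möbius cancellation along divisor classes -/

/-- Exchange of summation in the cofactor range: pairs `(n, e)` with `e ∣ n²+1`, `D < (n²+1)/e`,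
re-organised by the cofactor `e ≤ E` (given that every cofactor occurring is `≤ E`). -/
theorem sum_cofactorRange_comm {x y D E : ℕ} (hy : y ≤ x)
    (hE : ∀ n ∈ Icc 1 x, ∀ e ∈ (n ^ 2 + 1).divisors, D < (n ^ 2 + 1) / e → e ≤ E)
    (h : ℕ → ℕ → ℝ) :
    ∑ n ∈ Icc 1 y, ∑ e ∈ (n ^ 2 + 1).divisors with D < (n ^ 2 + 1) / e, h n e
      = ∑ e ∈ Icc 1 E, ∑ n ∈ (Icc 1 y).filter (fun n => e ∣ n ^ 2 + 1 ∧ e * D < n ^ 2 + 1),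
          h n e := by
  refine sum_comm' fun n e => ?_
  simp only [mem_filter, Nat.mem_divisors, mem_Icc]
  constructor
  · rintro ⟨hn, ⟨he, -⟩, hD⟩
    have hepos : 0 < e := Nat.pos_of_dvd_of_pos he (Nat.succ_pos _)
    refine ⟨⟨hn, he, (lt_div_iff_mul_lt_of_dvd hepos he).mp hD⟩, hepos, ?_⟩
    exact hE n (mem_Icc.mpr ⟨hn.1, hn.2.trans hy⟩) e (Nat.mem_divisors.mpr ⟨he, Nat.succ_ne_zero _⟩)
      hD
  · rintro ⟨⟨hn, he, hD⟩, hepos, -⟩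
    exact ⟨hn, ⟨he, Nat.succ_ne_zero _⟩, (lt_div_iff_mul_lt_of_dvd hepos he).mpr hD⟩

/-- **The cofactor range bound.**  If every cofactor `e` occurring (i.e. `e ∣ n²+1`, `(n²+1)/e > D`,
`n ≤ x`) is `≤ E`, and the Möbius sums along each divisor class are bounded,
`|∑_{n ≤ y, e ∣ n²+1} μ((n²+1)/e)| ≤ M(e)` for all `y ≤ x`, then
`|∑_{n ≤ x} ∑_{e ∣ n²+1, (n²+1)/e > D} μ((n²+1)/e) log((n²+1)/e)| ≤ 2 (2 log(x²+1) + log E) ∑_{e ≤ E} M(e)`. -/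
theorem abs_cofactorRange_le (x D E : ℕ) (M : ℕ → ℝ)
    (hE : ∀ n ∈ Icc 1 x, ∀ e ∈ (n ^ 2 + 1).divisors, D < (n ^ 2 + 1) / e → e ≤ E)
    (hM : ∀ e ∈ Icc 1 E, ∀ y ≤ x,
      |∑ n ∈ (Icc 1 y).filter (fun n => e ∣ n ^ 2 + 1), (μ ((n ^ 2 + 1) / e) : ℝ)| ≤ M e) :
    |∑ n ∈ Icc 1 x, ∑ e ∈ (n ^ 2 + 1).divisors with D < (n ^ 2 + 1) / e,
        (μ ((n ^ 2 + 1) / e) : ℝ) * Real.log (((n ^ 2 + 1) / e : ℕ) : ℝ)|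
      ≤ 2 * (2 * Real.log ((x : ℝ) ^ 2 + 1) + Real.log E) * ∑ e ∈ Icc 1 E, M e := by
  -- the summand: `log((n²+1)/e) = log(n²+1) - log e`
  have hsplit : ∀ n ∈ Icc 1 x, ∑ e ∈ (n ^ 2 + 1).divisors with D < (n ^ 2 + 1) / e,
      (μ ((n ^ 2 + 1) / e) : ℝ) * Real.log (((n ^ 2 + 1) / e : ℕ) : ℝ)
      = (∑ e ∈ (n ^ 2 + 1).divisors with D < (n ^ 2 + 1) / e, (μ ((n ^ 2 + 1) / e) : ℝ))
          * Real.log (((n ^ 2 + 1 : ℕ) : ℝ))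
        - ∑ e ∈ (n ^ 2 + 1).divisors with D < (n ^ 2 + 1) / e,
            (μ ((n ^ 2 + 1) / e) : ℝ) * Real.log e := by
    intro n _
    rw [sum_mul, ← sum_sub_distrib]
    refine sum_congr rfl fun e he => ?_
    have hed : e ∣ n ^ 2 + 1 := Nat.dvd_of_mem_divisors (mem_filter.mp he).1
    have hepos : 0 < e := Nat.pos_of_mem_divisors (mem_filter.mp he).1
    rw [Nat.cast_div hed (by exact_mod_cast hepos.ne'), Real.log_div (by positivity)
      (by exact_mod_cast hepos.ne')]
    ring
  rw [sum_congr rfl hsplit, sum_sub_distrib]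
  have hMnn : ∀ e ∈ Icc 1 E, 0 ≤ M e := fun e he => (abs_nonneg _).trans (hM e he 0 (Nat.zero_le _))
  have hSM : 0 ≤ ∑ e ∈ Icc 1 E, M e := sum_nonneg hMnn
  -- partial sums of `c(n) = ∑_{e, cut} μ((n²+1)/e)` are bounded by `2 ∑ M`
  have hpartial : ∀ y ≤ x, |∑ n ∈ Icc 1 y, ∑ e ∈ (n ^ 2 + 1).divisors with D < (n ^ 2 + 1) / e,
      (μ ((n ^ 2 + 1) / e) : ℝ)| ≤ 2 * ∑ e ∈ Icc 1 E, M e := by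
    intro y hy
    rw [sum_cofactorRange_comm hy hE (fun n e => (μ ((n ^ 2 + 1) / e) : ℝ)), mul_sum]
    refine (abs_sum_le_sum_abs _ _).trans (sum_le_sum fun e he => ?_)
    exact abs_sum_filter_dvd_cut_le hy (hM e he)
  -- B1: Abel summation against `w(n) = log(n²+1)`
  have hB1 : |∑ n ∈ Icc 1 x, (∑ e ∈ (n ^ 2 + 1).divisors with D < (n ^ 2 + 1) / e,
      (μ ((n ^ 2 + 1) / e) : ℝ)) * Real.log (((n ^ 2 + 1 : ℕ) : ℝ))|
      ≤ 2 * (2 * ∑ e ∈ Icc 1 E, M e) * Real.log (((x ^ 2 + 1 : ℕ) : ℝ)) := by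
    refine abs_sum_Icc_mul_le_of_monotone (w := fun n : ℕ => Real.log (((n ^ 2 + 1 : ℕ) : ℝ)))
      (fun a b hab => ?_) (by simp) hpartial
    exact Real.log_le_log (by positivity) (by exact_mod_cast Nat.succ_le_succ (Nat.pow_le_pow_left hab 2))
  -- B2: organised by the cofactor, weights `log e ≤ log E`
  have hB2 : |∑ n ∈ Icc 1 x, ∑ e ∈ (n ^ 2 + 1).divisors with D < (n ^ 2 + 1) / e,
      (μ ((n ^ 2 + 1) / e) : ℝ) * Real.log e| ≤ Real.log E * (2 * ∑ e ∈ Icc 1 E, M e) := by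
    rw [sum_cofactorRange_comm le_rfl hE]
    calc _ ≤ _ := abs_sum_le_sum_abs _ _
      _ ≤ ∑ e ∈ Icc 1 E, Real.log E * (2 * M e) := sum_le_sum fun e he => by
          have he1 : 1 ≤ e := (mem_Icc.mp he).1
          have hlog : 0 ≤ Real.log e := Real.log_natCast_nonneg e
          have hlogE : Real.log e ≤ Real.log E :=
            Real.log_le_log (by exact_mod_cast he1) (by exact_mod_cast (mem_Icc.mp he).2)
          rw [← sum_mul, abs_mul, abs_of_nonneg hlog, mul_comm]
          exact mul_le_mul hlogE (abs_sum_filter_dvd_cut_le le_rfl (hM e he)) (abs_nonneg _)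
            (hlog.trans hlogE)
      _ = Real.log E * (2 * ∑ e ∈ Icc 1 E, M e) := by rw [← mul_sum, ← mul_sum]
  have hcast : Real.log (((x ^ 2 + 1 : ℕ) : ℝ)) = Real.log ((x : ℝ) ^ 2 + 1) := by push_cast; ring_nf
  rw [hcast] at hB1
  calc _ ≤ _ := abs_sub _ _
    _ ≤ 2 * (2 * ∑ e ∈ Icc 1 E, M e) * Real.log ((x : ℝ) ^ 2 + 1)
        + Real.log E * (2 * ∑ e ∈ Icc 1 E, M e) := add_le_add hB1 hB2
    _ = 2 * (2 * Real.log ((x : ℝ) ^ 2 + 1) + Real.log E) * ∑ e ∈ Icc 1 E, M e := by ring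

end Summit.Parity.BatemanHorn.Theorems
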